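import Literature.AlgebraicGeometry.Motives.ProjectiveBundleOfQuotient
import Literature.AlgebraicGeometry.Motives.GrassmannianUniversalSubbundleSections
import Literature.AlgebraicGeometry.Modules.PullbackAlgebraUnit
import Literature.AlgebraicGeometry.Modules.PullbackAffineChart
import HarnessLib

/-!
# The tautological quotient of `P(G) ↪ X × Gr₁` on generators: `λ(η_p(φ ε_j)) = η(q_j)`

Topic `AlgebraicGeometry/Motives`; namespace `Literature.AlgebraicGeometry.Motives.Grassmannian.ProjBundle`. DEFINITIONS with
bodies (`unitToUnit`, `ιFreeHom`, `tautFrameIso` — Scheme-module-typed names for Mathlib's canonical maps) and theorems; no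
instance, no notation, no named fact, no `sorry`.

Sequel of ★ `Motives/ProjectiveBundleOfQuotient` (the incidence subscheme `P(G) = V(u_φ) ↪ X × Gr₁(M)` of an epimorphism
`φ : 𝒪_X^{(J)} ↠ G`, its projection `proj`, classifying map `toGr`, tautological line bundle `L = toGr^*𝒬` and the EXISTENCE of
the tautological epimorphism `λ : proj^*G ↠ L`). Here the tautological quotient is PINNED DOWN ON GENERATORS — the section-level
content of Hartshorne II Prop. 7.11 (b) «the surjection `π^*ℰ → 𝒪(1)`» / Prop. 7.12: `λ` sends the pulled-back generator
`η_{proj}(φ(ε_j))` of `proj^*G` to the pulled-back universal section `η_{toGr}(q_j)` of `L` (`exists_epi_tautQuot_app_unitSection`).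
This is what identifies, for a `T`-point `(f, g)` of `P(G)`, the quotient `f^*G ↠ (f,g)^*L` with the quotient of `𝒪_T ⊗ M`
classified by `g` — the input of the local triviality of `P(G) → X` (the sequel).

* §1 the canonical maps on pulled-back sections (Mathlib `SheafOfModules.pullbackObjUnitToUnit`, `ιFree`, `pullbackObjFreeIso`, in
  the `Scheme.Modules` typing of ★ `ProjBundle.pullbackFreeIso`): `unitToUnit_app_unitSection` (`e₀(η_f a) = f♯ a`, transpose of the
  algebra unit ★ `Modules/PullbackAlgebraUnit`), `ιFreeHom_app_one` (`ε_i|_U = ι_i(1)`), **`pullbackFreeIso_hom_app_unitSection`**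
  (`(f^*𝒪^{(I)} ≅ 𝒪^{(I)})(η_f ε_i) = ε_i`, Mathlib `pullback_map_ιFree_comp_pullbackObjFreeIso_hom`) and the inverse form;
* §2 `tautFrameIso : proj^*𝒪_X^{(J)} ≅ toGr^*𝒪_{Gr}^{(J)}` (the explicit isomorphism `γ` of ★ `exists_pullback_kernel_ι_comp_eq_zero`:
  pseudofunctor isomorphisms `Scheme.Modules.pullbackComp` around `ι^*` of the free-module identifications),
  `tautFrameIso_hom_app_unitSection` (`γ(η_{proj} ε_j) = η_{toGr} ε_j`, by ★ `pullbackComp_{hom,inv}_app_unitSection`,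
  ★ `pullback_map_app_unitSection` and §1), `pullback_kernel_ι_comp_tautFrameIso_eq_zero` (the incidence relation with THIS `γ`);
* §3 **`exists_epi_tautQuot_app_unitSection`** — an epimorphism `λ : proj^*G ↠ L` with `proj^*φ ≫ λ = γ ≫ toGr^*π` AND
  `λ(η_{proj}(φ ε_j)) = η_{toGr}(q_j)` for all `j`.

## References
* [Hartshorne1977] R. Hartshorne, *Algebraic Geometry* (1977), II §7 Prop. 7.11 (b), Prop. 7.12; II §5 p. 110.
* [GortzWedhorn2020] U. Görtz, T. Wedhorn, *Algebraic Geometry I*, 2nd ed. (2020), (8.4) (pp. 213–215), (13.8).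
* [StacksProject] The Stacks Project, Tag 01AK, Tag 01CB.
-/

noncomputable section

open CategoryTheory CategoryTheory.Limits Opposite TopologicalSpace AlgebraicGeometry
open Literature.AlgebraicGeometry.Modules

universe u

namespace Literature.AlgebraicGeometry.Motives.Grassmannian

namespace ProjBundle

/-! ## §1 The canonical maps `f^*𝒪 ⟶ 𝒪`, `𝒪 ⟶ 𝒪^{(I)}`, `f^*𝒪^{(I)} ≅ 𝒪^{(I)}` on pulled-back sections -/

section Canonical

variable {X Y : Scheme.{u}} (f : X ⟶ Y)

/-- Mathlib's canonical `e₀ : f^*𝒪_Y ⟶ 𝒪_X` (`SheafOfModules.pullbackObjUnitToUnit`, the transpose of the algebra unit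
`f♯ : 𝒪_Y ⟶ f_*𝒪_X`), typed as a morphism of `𝒪_X`-modules. [cite: StacksProject, Tag 01AK] -/
def unitToUnit : (Scheme.Modules.pullback f).obj (unitModule Y) ⟶ unitModule X :=
  SheafOfModules.pullbackObjUnitToUnit f.toRingCatSheafHom

/-- The `i`-th coprojection `ι_i : 𝒪_X ⟶ 𝒪_X^{(I)}` (Mathlib `SheafOfModules.ιFree`), typed as a morphism of `𝒪_X`-modules.
[cite: Hartshorne1977, II §5 p. 109] -/
def ιFreeHom (X : Scheme.{u}) (I : Type u) (i : I) : unitModule X ⟶ freeModule X I :=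
  SheafOfModules.ιFree i

/-- **`η_{𝒪_Y} ≫ f_*(e₀) = f♯`** (transpose of the algebra unit, ★ `algebraUnit_eq_unitToPushforwardObjUnit`).
[cite: StacksProject, Tag 01AK] [cite: Hartshorne1977, II §5 p. 110] -/
theorem pullbackUnit_comp_pushforward_map_unitToUnit :
    pullbackUnit f (unitModule Y) ≫ (Scheme.Modules.pushforward f).map (unitToUnit f) = algebraUnit f := by
  rw [unitToUnit, algebraUnit_eq_unitToPushforwardObjUnit,
    ← SheafOfModules.pullbackPushforwardAdjunction_homEquiv_pullbackObjUnitToUnit, Adjunction.homEquiv_unit]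
  rfl

/-- **`e₀(η_f(a)) = f♯(a)`** for `a ∈ Γ(Y, U)`. [cite: StacksProject, Tag 01AK] -/
theorem unitToUnit_app_unitSection (U : Y.Opens) (a : Γ(Y, U)) :
    (unitToUnit f).app (f ⁻¹ᵁ U) (unitSection f (unitModule Y) U a) = f.app U a := by
  have h := congrArg (fun ψ : unitModule Y ⟶ (Scheme.Modules.pushforward f).obj (unitModule X) =>
    (Scheme.Modules.Hom.app ψ U) a) (pullbackUnit_comp_pushforward_map_unitToUnit f)
  simp only [Scheme.Modules.Hom.comp_app] at h
  exact h

/-- `e₀(η_f(1)) = 1`. [cite: StacksProject, Tag 01AK] -/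
theorem unitToUnit_app_unitSection_one (U : Y.Opens) :
    (unitToUnit f).app (f ⁻¹ᵁ U) (unitSection f (unitModule Y) U (1 : Γ(Y, U))) = (1 : Γ(X, f ⁻¹ᵁ U)) := by
  rw [unitToUnit_app_unitSection, map_one]

/-- **`ε_i|_U = ι_i(1|_U)`** (Mathlib `freeSection`, `unitHomEquiv_apply_coe`). [cite: Hartshorne1977, II §5 p. 109] -/
theorem ιFreeHom_app_one (I : Type u) (i : I) (U : X.Opens) :
    (ιFreeHom X I i).app U (1 : Γ(X, U)) = freeSectionOn X i U := by
  change _ = ((SheafOfModules.free (R := X.ringCatSheaf) I).unitHomEquiv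
    (SheafOfModules.ιFree i ≫ 𝟙 _)).val (op U)
  rw [Category.comp_id, SheafOfModules.unitHomEquiv_apply_coe]
  rfl

/-- Mathlib's `pullback_map_ιFree_comp_pullbackObjFreeIso_hom` in the present typing:
`f^*(ι_i) ≫ (f^*𝒪^{(I)} ≅ 𝒪^{(I)}) = e₀ ≫ ι_i`. [cite: StacksProject, Tag 01AK] -/
theorem pullback_map_ιFreeHom_comp_pullbackFreeIso_hom (I : Type u) (i : I) :
    (Scheme.Modules.pullback f).map (ιFreeHom Y I i) ≫ (pullbackFreeIso f I).hom = unitToUnit f ≫ ιFreeHom X I i :=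
  haveI := KTheory.final_opensMap f
  SheafOfModules.pullback_map_ιFree_comp_pullbackObjFreeIso_hom f.toRingCatSheafHom i

/-- **`(f^*𝒪_Y^{(I)} ≅ 𝒪_X^{(I)})(η_f(ε_i|_U)) = ε_i|_{f⁻¹U}`** for the canonical identification ★ `pullbackFreeIso`.
[cite: StacksProject, Tag 01AK] [cite: Hartshorne1977, II §5 p. 110] -/
theorem pullbackFreeIso_hom_app_unitSection (I : Type u) (i : I) (U : Y.Opens) :
    (pullbackFreeIso f I).hom.app (f ⁻¹ᵁ U) (unitSection f (freeModule Y I) U (freeSectionOn Y i U)) =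
      freeSectionOn X i (f ⁻¹ᵁ U) := by
  have h' := congrArg (fun ψ : (Scheme.Modules.pullback f).obj (unitModule Y) ⟶ freeModule X I =>
    (Scheme.Modules.Hom.app ψ (f ⁻¹ᵁ U)) (unitSection f (unitModule Y) U (1 : Γ(Y, U))))
    (pullback_map_ιFreeHom_comp_pullbackFreeIso_hom f I i)
  simp only [Scheme.Modules.Hom.comp_app, CategoryTheory.comp_apply] at h'
  rw [pullback_map_app_unitSection, ιFreeHom_app_one, unitToUnit_app_unitSection_one, ιFreeHom_app_one] at h'
  exact h'

/-- Inverse form: **`(𝒪_X^{(I)} ≅ f^*𝒪_Y^{(I)})(ε_i|_{f⁻¹U}) = η_f(ε_i|_U)`**. [cite: StacksProject, Tag 01AK] -/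
theorem pullbackFreeIso_inv_app_freeSectionOn (I : Type u) (i : I) (U : Y.Opens) :
    (pullbackFreeIso f I).inv.app (f ⁻¹ᵁ U) (freeSectionOn X i (f ⁻¹ᵁ U)) =
      unitSection f (freeModule Y I) U (freeSectionOn Y i U) := by
  have h' := congrArg (fun ψ : (Scheme.Modules.pullback f).obj (freeModule Y I) ⟶
      (Scheme.Modules.pullback f).obj (freeModule Y I) =>
    (Scheme.Modules.Hom.app ψ (f ⁻¹ᵁ U)) (unitSection f (freeModule Y I) U (freeSectionOn Y i U)))
    (pullbackFreeIso f I).hom_inv_id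
  simp only [Scheme.Modules.Hom.comp_app, CategoryTheory.comp_apply, Scheme.Modules.Hom.id_app,
    CategoryTheory.id_apply] at h'
  rw [pullbackFreeIso_hom_app_unitSection] at h'
  exact h'

end Canonical

/-! ## §2 The explicit frame isomorphism `γ : proj^*𝒪_X^{(J)} ≅ toGr^*𝒪_{Gr}^{(J)}` and its value on generators -/

section Frame

variable {X : Scheme.{u}} (M : Type u) [AddCommGroup M] {J : Type u} (b : Module.Basis J ℤ M)
  [(grassmannianSheaf M 1).obj.IsRepresentable] {G : X.Modules} (φ : freeModule X J ⟶ G)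

/-- **The frame isomorphism `γ : proj^*𝒪_X^{(J)} ≅ toGr^*𝒪_{Gr}^{(J)}` on `P(G)`**: `proj^* = (ι ≫ pr₁)^* ≅ ι^* pr₁^*` (Mathlib
`Scheme.Modules.pullbackComp`), then `ι^*` of `pr₁^*𝒪_X^{(J)} ≅ 𝒪^{(J)} ≅ pr₂^*𝒪_{Gr}^{(J)}` (★ `pullbackFreeIso`), then
`ι^* pr₂^* ≅ (ι ≫ pr₂)^* = toGr^*` — the isomorphism `γ` of ★ `exists_pullback_kernel_ι_comp_eq_zero`, now with a name.
[cite: Hartshorne1977, II §5 p. 110] [cite: GortzWedhorn2020, (8.4) (pp. 213–215)] -/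
def tautFrameIso :
    (Scheme.Modules.pullback (proj M b φ)).obj (freeModule X J) ≅
      (Scheme.Modules.pullback (toGr M b φ)).obj (freeModule (grassmannianScheme M 1) J) :=
  ((Scheme.Modules.pullbackComp (totalι M b φ) (prod.fst : X ⨯ grassmannianScheme M 1 ⟶ X)).app
      (freeModule X J)).symm ≪≫
    (Scheme.Modules.pullback (totalι M b φ)).mapIso
      (pullbackFreeIso (prod.fst : X ⨯ grassmannianScheme M 1 ⟶ X) J ≪≫
        (pullbackFreeIso (prod.snd : X ⨯ grassmannianScheme M 1 ⟶ grassmannianScheme M 1) J).symm) ≪≫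
    (Scheme.Modules.pullbackComp (totalι M b φ)
      (prod.snd : X ⨯ grassmannianScheme M 1 ⟶ grassmannianScheme M 1)).app (freeModule (grassmannianScheme M 1) J)

/-- **`γ(η_{proj}(ε_j)) = η_{toGr}(ε_j)`**: the frame isomorphism matches the pulled-back tautological generators (computed
through `η_{proj} ε_j ↦ η_ι(η_{pr₁} ε_j) ↦ η_ι(ε_j) ↦ η_ι(η_{pr₂} ε_j) ↦ η_{toGr} ε_j`, ★ `pullbackComp_{inv,hom}_app_unitSection`,
★ `pullback_map_app_unitSection`, §1). [cite: Hartshorne1977, II §5 p. 110] -/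
theorem tautFrameIso_hom_app_unitSection (j : J) :
    (tautFrameIso M b φ).hom.app ((proj M b φ) ⁻¹ᵁ ⊤)
        (unitSection (proj M b φ) (freeModule X J) ⊤ (freeSectionOn X j ⊤)) =
      unitSection (toGr M b φ) (freeModule (grassmannianScheme M 1) J) ⊤
        (freeSectionOn (grassmannianScheme M 1) j ⊤) := by
  have step : (tautFrameIso M b φ).hom =
      (Scheme.Modules.pullbackComp (totalι M b φ) (prod.fst : X ⨯ grassmannianScheme M 1 ⟶ X)).inv.app
          (freeModule X J) ≫
        (Scheme.Modules.pullback (totalι M b φ)).map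
          ((pullbackFreeIso (prod.fst : X ⨯ grassmannianScheme M 1 ⟶ X) J).hom ≫
            (pullbackFreeIso (prod.snd : X ⨯ grassmannianScheme M 1 ⟶ grassmannianScheme M 1) J).inv) ≫
        (Scheme.Modules.pullbackComp (totalι M b φ)
          (prod.snd : X ⨯ grassmannianScheme M 1 ⟶ grassmannianScheme M 1)).hom.app
            (freeModule (grassmannianScheme M 1) J) := rfl
  rw [step, Scheme.Modules.Hom.comp_app, Scheme.Modules.Hom.comp_app, CategoryTheory.comp_apply,
    CategoryTheory.comp_apply]
  erw [pullbackComp_inv_app_unitSection (prod.fst : X ⨯ grassmannianScheme M 1 ⟶ X) (freeModule X J)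
    (totalι M b φ) ⊤ (freeSectionOn X j ⊤)]
  erw [pullback_map_app_unitSection (totalι M b φ)
    ((pullbackFreeIso (prod.fst : X ⨯ grassmannianScheme M 1 ⟶ X) J).hom ≫
      (pullbackFreeIso (prod.snd : X ⨯ grassmannianScheme M 1 ⟶ grassmannianScheme M 1) J).inv)
    ((prod.fst : X ⨯ grassmannianScheme M 1 ⟶ X) ⁻¹ᵁ ⊤)
    (unitSection (prod.fst : X ⨯ grassmannianScheme M 1 ⟶ X) (freeModule X J) ⊤ (freeSectionOn X j ⊤))]
  rw [Scheme.Modules.Hom.comp_app, CategoryTheory.comp_apply,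
    pullbackFreeIso_hom_app_unitSection (prod.fst : X ⨯ grassmannianScheme M 1 ⟶ X) J j ⊤]
  -- the open `pr₁⁻¹ ⊤` is `pr₂⁻¹ ⊤` (both are `⊤`, definitionally): transport the remaining two formulas
  have hinv : (pullbackFreeIso (prod.snd : X ⨯ grassmannianScheme M 1 ⟶ grassmannianScheme M 1) J).inv.app
      ((prod.fst : X ⨯ grassmannianScheme M 1 ⟶ X) ⁻¹ᵁ ⊤)
      (freeSectionOn (X ⨯ grassmannianScheme M 1) j ((prod.fst : X ⨯ grassmannianScheme M 1 ⟶ X) ⁻¹ᵁ ⊤)) =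
      unitSection (prod.snd : X ⨯ grassmannianScheme M 1 ⟶ grassmannianScheme M 1)
        (freeModule (grassmannianScheme M 1) J) ⊤ (freeSectionOn (grassmannianScheme M 1) j ⊤) :=
    pullbackFreeIso_inv_app_freeSectionOn (prod.snd : X ⨯ grassmannianScheme M 1 ⟶ grassmannianScheme M 1) J j ⊤
  rw [hinv]
  exact pullbackComp_hom_app_unitSection (prod.snd : X ⨯ grassmannianScheme M 1 ⟶ grassmannianScheme M 1)
    (freeModule (grassmannianScheme M 1) J) (totalι M b φ) ⊤ (freeSectionOn (grassmannianScheme M 1) j ⊤)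

variable [Fintype J] [Epi φ]

/-- **The incidence relation with the explicit frame isomorphism**: `proj^*(ker φ ↪ 𝒪^{(J)}) ≫ γ ≫ toGr^*π = 0` (the proof of
★ `exists_pullback_kernel_ι_comp_eq_zero`, run with the pseudofunctor isomorphisms as data). [cite: Hartshorne1977, II §7 Prop. 7.12]
[cite: Fulton1998, B.3.4] -/
theorem pullback_kernel_ι_comp_tautFrameIso_eq_zero (hG : IsFiniteLocallyFree G) :
    (Scheme.Modules.pullback (proj M b φ)).map (kernel.ι φ) ≫ (tautFrameIso M b φ).hom ≫
      (Scheme.Modules.pullback (toGr M b φ)).map (universalQuotientπ 1 M b) = 0 := by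
  -- the argument of ★ `exists_pullback_kernel_ι_comp_eq_zero`, with the identifications as variables
  have key : ∀ (d₁K : (Scheme.Modules.pullback (totalι M b φ)).obj
      ((Scheme.Modules.pullback (prod.fst : X ⨯ grassmannianScheme M 1 ⟶ X)).obj (kernel φ)) ≅
      (Scheme.Modules.pullback (proj M b φ)).obj (kernel φ))
      (d₁F : (Scheme.Modules.pullback (totalι M b φ)).obj
        ((Scheme.Modules.pullback (prod.fst : X ⨯ grassmannianScheme M 1 ⟶ X)).obj (freeModule X J)) ≅
        (Scheme.Modules.pullback (proj M b φ)).obj (freeModule X J))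
      (_ : d₁K.hom ≫ (Scheme.Modules.pullback (proj M b φ)).map (kernel.ι φ) =
        (Scheme.Modules.pullback (totalι M b φ)).map ((Scheme.Modules.pullback prod.fst).map (kernel.ι φ)) ≫ d₁F.hom)
      (d₂F : (Scheme.Modules.pullback (totalι M b φ)).obj
        ((Scheme.Modules.pullback (prod.snd : X ⨯ grassmannianScheme M 1 ⟶ grassmannianScheme M 1)).obj
          (freeModule (grassmannianScheme M 1) J)) ≅
        (Scheme.Modules.pullback (toGr M b φ)).obj (freeModule (grassmannianScheme M 1) J))
      (d₂Q : (Scheme.Modules.pullback (totalι M b φ)).obj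
        ((Scheme.Modules.pullback (prod.snd : X ⨯ grassmannianScheme M 1 ⟶ grassmannianScheme M 1)).obj
          (universalQuotient 1 M b)) ≅ lineBundle M b φ)
      (_ : d₂F.hom ≫ (Scheme.Modules.pullback (toGr M b φ)).map (universalQuotientπ 1 M b) =
        (Scheme.Modules.pullback (totalι M b φ)).map
          ((Scheme.Modules.pullback prod.snd).map (universalQuotientπ 1 M b)) ≫ d₂Q.hom),
      (Scheme.Modules.pullback (proj M b φ)).map (kernel.ι φ) ≫
        (d₁F.symm ≪≫ (Scheme.Modules.pullback (totalι M b φ)).mapIso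
          (pullbackFreeIso prod.fst J ≪≫ (pullbackFreeIso prod.snd J).symm) ≪≫ d₂F).hom ≫
        (Scheme.Modules.pullback (toGr M b φ)).map (universalQuotientπ 1 M b) = 0 := by
    intro d₁K d₁F n₁ d₂F d₂Q n₂
    have h0 := pullback_totalι_incidence_eq_zero M b φ hG
    unfold incidence at h0
    simp only [Functor.map_comp] at h0
    rw [← cancel_epi d₁K.hom, comp_zero, reassoc_of% n₁]
    simp only [Iso.trans_hom, Iso.symm_hom, Functor.mapIso_hom, Functor.map_comp, Category.assoc,
      Iso.hom_inv_id_assoc]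
    rw [n₂, reassoc_of% h0, zero_comp]
  exact key ((Scheme.Modules.pullbackComp (totalι M b φ) prod.fst).app (kernel φ))
    ((Scheme.Modules.pullbackComp (totalι M b φ) prod.fst).app (freeModule X J))
    ((Scheme.Modules.pullbackComp (totalι M b φ) prod.fst).hom.naturality (kernel.ι φ)).symm
    ((Scheme.Modules.pullbackComp (totalι M b φ) prod.snd).app (freeModule _ J))
    ((Scheme.Modules.pullbackComp (totalι M b φ) prod.snd).app (universalQuotient 1 M b))
    ((Scheme.Modules.pullbackComp (totalι M b φ) prod.snd).hom.naturality (universalQuotientπ 1 M b)).symm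

/-! ## §3 The tautological quotient on generators -/

/-- **THE TAUTOLOGICAL QUOTIENT ON GENERATORS.** There is an epimorphism `λ : proj^*G ↠ L` (the tautological quotient of
★ `exists_epi_tautQuot`, for the explicit frame isomorphism `γ = tautFrameIso`) with `proj^*φ ≫ λ = γ ≫ toGr^*π` and,
ON THE PULLED-BACK GENERATORS, **`λ(η_{proj}(φ ε_j)) = η_{toGr}(q_j)`** — the pulled-back universal sections of the
Grassmannian: «`π^*ℰ → 𝒪(1)` sends the generating sections to the tautological ones» (Hartshorne II 7.11 (b)/7.12;
Görtz–Wedhorn (13.8): a `T`-point of `ℙ(ℰ)` over `f` IS the line-bundle quotient `f^*ℰ ↠ ℒ`).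
[cite: Hartshorne1977, II §7 Prop. 7.11 (b), Prop. 7.12] [cite: GortzWedhorn2020, (13.8)] -/
theorem exists_epi_tautQuot_app_unitSection (hG : IsFiniteLocallyFree G) :
    ∃ lam : (Scheme.Modules.pullback (proj M b φ)).obj G ⟶ lineBundle M b φ, Epi lam ∧
      (Scheme.Modules.pullback (proj M b φ)).map φ ≫ lam =
        (tautFrameIso M b φ).hom ≫ (Scheme.Modules.pullback (toGr M b φ)).map (universalQuotientπ 1 M b) ∧
      ∀ j : J, lam.app ((proj M b φ) ⁻¹ᵁ ⊤) (unitSection (proj M b φ) G ⊤ (φ.app ⊤ (freeSectionOn X j ⊤))) =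
        unitSection (toGr M b φ) (universalQuotient 1 M b) ⊤ (universalQuotientSection 1 M b j) := by
  have hγ := pullback_kernel_ι_comp_tautFrameIso_eq_zero M b φ hG
  haveI := epi_universalQuotientπ 1 M b
  have hc := Abelian.epiIsCokernelOfKernel (KernelFork.ofι (kernel.ι φ) (kernel.condition φ)) (kernelIsKernel φ)
  haveI := (Scheme.Modules.pullbackPushforwardAdjunction (proj M b φ)).leftAdjoint_preservesColimits
  have hc' := isColimitCoforkMapOfIsColimit (Scheme.Modules.pullback (proj M b φ))
    (show kernel.ι φ ≫ φ = 0 ≫ φ by rw [zero_comp]; exact kernel.condition φ) hc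
  have w : (Scheme.Modules.pullback (proj M b φ)).map (kernel.ι φ) ≫
      ((tautFrameIso M b φ).hom ≫ (Scheme.Modules.pullback (toGr M b φ)).map (universalQuotientπ 1 M b)) =
      (Scheme.Modules.pullback (proj M b φ)).map 0 ≫
        ((tautFrameIso M b φ).hom ≫ (Scheme.Modules.pullback (toGr M b φ)).map (universalQuotientπ 1 M b)) := by
    rw [hγ, Functor.map_zero, zero_comp]
  obtain ⟨l, hl⟩ := Cofork.IsColimit.desc' hc' _ w
  rw [Cofork.π_ofπ] at hl
  haveI : Epi ((Scheme.Modules.pullback (toGr M b φ)).map (universalQuotientπ 1 M b)) :=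
    (Scheme.Modules.pullback (toGr M b φ)).map_epi _
  haveI : Epi ((tautFrameIso M b φ).hom ≫ (Scheme.Modules.pullback (toGr M b φ)).map (universalQuotientπ 1 M b)) :=
    epi_comp _ _
  refine ⟨l, epi_of_epi_fac hl, hl, fun j => ?_⟩
  have e1 : unitSection (proj M b φ) G ⊤ (φ.app ⊤ (freeSectionOn X j ⊤)) =
      ((Scheme.Modules.pullback (proj M b φ)).map φ).app ((proj M b φ) ⁻¹ᵁ ⊤)
        (unitSection (proj M b φ) (freeModule X J) ⊤ (freeSectionOn X j ⊤)) :=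
    (pullback_map_app_unitSection (proj M b φ) φ ⊤ (freeSectionOn X j ⊤)).symm
  have hl' : (Scheme.Modules.pullback (proj M b φ)).map φ ≫ (l : (Scheme.Modules.pullback (proj M b φ)).obj G ⟶ _) =
      (tautFrameIso M b φ).hom ≫ (Scheme.Modules.pullback (toGr M b φ)).map (universalQuotientπ 1 M b) := hl
  have h2 := congrArg (fun ψ : (Scheme.Modules.pullback (proj M b φ)).obj (freeModule X J) ⟶ lineBundle M b φ =>
    (Scheme.Modules.Hom.app ψ ((proj M b φ) ⁻¹ᵁ ⊤)) (unitSection (proj M b φ) (freeModule X J) ⊤ (freeSectionOn X j ⊤))) hl'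
  simp only [Scheme.Modules.Hom.comp_app, CategoryTheory.comp_apply] at h2
  rw [e1, h2, tautFrameIso_hom_app_unitSection]
  erw [pullback_map_app_unitSection (toGr M b φ) (universalQuotientπ 1 M b) ⊤
    (freeSectionOn (grassmannianScheme M 1) j ⊤)]
  rw [universalQuotientπ_app_top_freeSectionOn]

end Frame

end ProjBundle

end Literature.AlgebraicGeometry.Motives.Grassmannian

end
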